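import Summits.Ventures.PercRepro.ProfilePointedCircuitClassesStarSharpC
import Summits.Ventures.PercRepro.ProfilePointedParallel

/-!
# PercRepro — THE PARALLEL-TWIN REGIME OF THE SHARP (★): THE `b′`-AVOIDING TWO-POINT INEQUALITY HOLDS AT EVERY `(e, f)`
WHERE `f` HAS A PARALLEL TWIN, AND IS AN IDENTITY WHEN `e ∥ f` (p5, gen 53; `proofs/P5-GM1.md` §80 ADD 4, cases A and B)

`StarNineSharp` (StarSharpC) asks, on nine points with a series pair `{b, b′}`, the inequality
`in_4(e) + thru_4({b′, f}) + thru_4({b′, e, f}) ≤ in_4(f) + thru_4({e, f}) + thru_4({b′, e})`, i.e. (★) for the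
bi-independent sets AVOIDING `b′`: `#{W : e ∈ W ∌ f, b′ ∉ W} ≤ #{W : f ∈ W, b′ ∉ W}` (`inCount_thru_split`).  When `f`
has a PARALLEL twin `y` (`ρ{f, y} = 1`, `y ∉ {e, b′}`), every bi-independent set contains exactly one of `f, y`
(`W` and `E ∖ W` are independent: `mem_or_mem_of_parallel`, `not_and_of_parallel`), and the swap `W ↦ W − y + f` is a
bijection of the bi-independent sets (`swap_mem_biIndepSets_of_parallel`, `card_filter_swap_of_parallel`: parallel
elements are interchangeable in every rank, `rk_insert_eq_of_parallel'`), so the sets `W ∋ e ∌ f` avoiding `b′` are the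
sets `W ∋ e, y` avoiding `b′, f`, as many as the sets `W ∋ e, f` avoiding `b′, y`, which contain `f` and avoid `b′`:
**`inCount_thru_le_of_parallel`** — for EVERY finite matroid, every level `k` and every `b′` (no series pair, no size
hypothesis); its instance is the `f`-parallel regime of `StarNineSharp` (12,260 of the 279,552 catalogue
configurations, §80).  When `e ∥ f` the same swap gives EQUALITY (`inCount_thru_eq_of_parallel`: no set contains both,
the two through-counts vanish, `in(e) = in(f)` and `thru({b′, e}) = thru({b′, f})`).  Nothing here asserts the Prop.
-/

open scoped Matroid

namespace PercRepro.Cogirth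

open Finset ThmH Skew Shadow Profile

variable {α : Type} [DecidableEq α] {N : Matroid α} [N.Finite]

section StarSharpP

/-- **THE PARALLEL SWAP**: for a parallel pair `{f, y}` of non-loops and a bi-independent `k`-set `W ∋ y` with `f ∉ W`,
the set `W − y + f` is bi-independent (`ρ(W − y + f) = ρ(W)`, `ρ((E ∖ W) − f + y) = ρ(E ∖ W)`). -/
theorem swap_mem_biIndepSets_of_parallel {f y : α} (hf : f ∈ gr N) (hy : y ∈ gr N) (hfy' : f ≠ y)
    (hf1 : rk N {f} = 1) (hy1 : rk N {y} = 1) (hfy : rk N {f, y} = 1) {k : ℕ} {W : Finset α}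
    (hW : W ∈ biIndepSets N k) (hyW : y ∈ W) (hfW : f ∉ W) :
    insert f (W.erase y) ∈ biIndepSets N k := by
  obtain ⟨hWg, hWc, hWr, hWcompl⟩ := mem_biIndepSets.1 hW
  have hY : W.erase y ⊆ gr N := (erase_subset _ _).trans hWg
  have hfY : f ∉ W.erase y := fun h' => hfW (mem_of_mem_erase h')
  have hfc : f ∈ gr N \ W := mem_sdiff.2 ⟨hf, hfW⟩
  have hZ : (gr N \ W).erase f ⊆ gr N := (erase_subset _ _).trans sdiff_subset
  have hyZ : y ∉ (gr N \ W).erase f := fun h' => (mem_sdiff.1 (mem_of_mem_erase h')).2 hyW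
  have hcompl : gr N \ insert f (W.erase y) = insert y ((gr N \ W).erase f) := by
    ext z
    simp only [mem_sdiff, mem_insert, mem_erase, not_or, not_and]
    constructor
    · rintro ⟨hzg, hzf, hzW⟩
      by_cases hzy : z = y
      · exact Or.inl hzy
      · exact Or.inr ⟨hzf, hzg, hzW hzy⟩
    · rintro (rfl | ⟨hzf, hzg, hzW⟩)
      · exact ⟨hy, hfy'.symm, fun hzy => absurd rfl hzy⟩
      · exact ⟨hzg, hzf, fun _ => hzW⟩
  rw [mem_biIndepSets]
  refine ⟨insert_subset hf hY, ?_, ?_, ?_⟩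
  · rw [card_insert_of_notMem hfY, card_erase_of_mem hyW]
    have := card_pos.2 ⟨y, hyW⟩
    omega
  · rw [rk_insert_eq_of_parallel' hf hy hf1 hy1 hfy hY, insert_erase hyW, hWr, card_insert_of_notMem hfY,
      card_erase_of_mem hyW]
    have := card_pos.2 ⟨y, hyW⟩
    omega
  · rw [hcompl, rk_insert_eq_of_parallel' hy hf hy1 hf1 (by rw [pair_comm]; exact hfy) hZ, insert_erase hfc,
      hWcompl, card_insert_of_notMem hyZ, card_erase_of_mem hfc]
    have := card_pos.2 ⟨f, hfc⟩
    omega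

/-- A bi-independent set contains at most one element of a parallel pair (it is independent). -/
theorem not_and_of_parallel {f y : α} (hfy' : f ≠ y) (hfy : rk N {f, y} = 1) {k : ℕ} {W : Finset α}
    (hW : W ∈ biIndepSets N k) : ¬ (f ∈ W ∧ y ∈ W) := by
  rintro ⟨hfW, hyW⟩
  exact not_pair_subset_of_parallel' hfy' hfy (mem_biIndepSets.1 hW).2.2.1
    (insert_subset hfW (singleton_subset_iff.2 hyW))

/-- A bi-independent set contains at least one element of a parallel pair of the ground set (its complement is
independent). -/
theorem mem_or_mem_of_parallel {f y : α} (hf : f ∈ gr N) (hy : y ∈ gr N) (hfy' : f ≠ y) (hfy : rk N {f, y} = 1)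
    {k : ℕ} {W : Finset α} (hW : W ∈ biIndepSets N k) : f ∈ W ∨ y ∈ W := by
  by_contra hcon
  rw [not_or] at hcon
  exact not_pair_subset_of_parallel' hfy' hfy (mem_biIndepSets.1 hW).2.2.2
    (insert_subset (mem_sdiff.2 ⟨hf, hcon.1⟩) (singleton_subset_iff.2 (mem_sdiff.2 ⟨hy, hcon.2⟩)))

/-- **THE PARALLEL SWAP COUNT**: the bi-independent `k`-sets with `y ∈ W`, `f ∉ W` and a swap-invariant property `P`
are as many as those with `f ∈ W`, `y ∉ W` and `P`. -/
theorem card_filter_swap_of_parallel {f y : α} (hf : f ∈ gr N) (hy : y ∈ gr N) (hfy' : f ≠ y)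
    (hf1 : rk N {f} = 1) (hy1 : rk N {y} = 1) (hfy : rk N {f, y} = 1) (k : ℕ) (P : Finset α → Prop)
    [DecidablePred P] (hP : ∀ W, P (insert f (W.erase y)) ↔ P W) (hP' : ∀ W, P (insert y (W.erase f)) ↔ P W) :
    ((biIndepSets N k).filter (fun W => (P W ∧ y ∈ W) ∧ f ∉ W)).card =
      ((biIndepSets N k).filter (fun W => (P W ∧ y ∉ W) ∧ f ∈ W)).card := by
  have hyf : rk N {y, f} = 1 := by rw [pair_comm]; exact hfy
  apply card_bij (fun W _ => insert f (W.erase y))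
  · intro W hW
    rw [mem_filter] at hW ⊢
    obtain ⟨hWb, ⟨hPW, hyW⟩, hfW⟩ := hW
    exact ⟨swap_mem_biIndepSets_of_parallel hf hy hfy' hf1 hy1 hfy hWb hyW hfW, ⟨(hP W).2 hPW,
      fun h' => (mem_insert.1 h').elim (fun h'' => hfy' h''.symm) (fun h'' => (mem_erase.1 h'').1 rfl)⟩,
      mem_insert_self _ _⟩
  · intro W₁ hW₁ W₂ hW₂ heq
    rw [mem_filter] at hW₁ hW₂
    have heq' : insert f (W₁.erase y) = insert f (W₂.erase y) := heq
    have hf₁ : f ∉ W₁.erase y := fun h' => hW₁.2.2 (mem_of_mem_erase h')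
    have hf₂ : f ∉ W₂.erase y := fun h' => hW₂.2.2 (mem_of_mem_erase h')
    have h1 : W₁.erase y = W₂.erase y := by
      rw [← erase_insert hf₁, ← erase_insert hf₂, heq']
    rw [← insert_erase hW₁.2.1.2, ← insert_erase hW₂.2.1.2, h1]
  · intro V hV
    rw [mem_filter] at hV
    obtain ⟨hVb, ⟨hPV, hyV⟩, hfV⟩ := hV
    have hyV' : y ∉ V.erase f := fun h' => hyV (mem_of_mem_erase h')
    refine ⟨insert y (V.erase f), ?_, ?_⟩
    · rw [mem_filter]
      exact ⟨swap_mem_biIndepSets_of_parallel hy hf hfy'.symm hy1 hf1 hyf hVb hfV hyV,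
        ⟨(hP' V).2 hPV, mem_insert_self _ _⟩,
        fun h' => (mem_insert.1 h').elim (fun h'' => hfy' h'') (fun h'' => (mem_erase.1 h'').1 rfl)⟩
    · show insert f ((insert y (V.erase f)).erase y) = V
      rw [erase_insert hyV', insert_erase hfV]

/-- The two-point inequality of `StarNineSharp` in cell form: `in_k(e) + thru_k({b′, f}) + thru_k({b′, e, f}) ≤
in_k(f) + thru_k({e, f}) + thru_k({b′, e})` iff `#{W : e ∈ W ∌ f, b′ ∉ W} ≤ #{W : f ∈ W, b′ ∉ W}`. -/
theorem inCount_thru_split (k : ℕ) (b' e f : α) :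
    (inCount N k e + thruCount N k {b', f} + thruCount N k {b', e, f} ≤
        inCount N k f + thruCount N k {e, f} + thruCount N k {b', e}) ↔
      ((biIndepSets N k).filter (fun W => (e ∈ W ∧ f ∉ W) ∧ b' ∉ W)).card ≤
        ((biIndepSets N k).filter (fun W => f ∈ W ∧ b' ∉ W)).card := by
  have he := card_filter_eq_sum_four (biIndepSets N k) (fun W => e ∈ W) f b'
  have hf := card_filter_eq_sum_two (biIndepSets N k) (fun W => f ∈ W) b'
  have h1 : thruCount N k {e, f} = ((biIndepSets N k).filter (fun W => (e ∈ W ∧ f ∈ W) ∧ b' ∈ W)).card +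
      ((biIndepSets N k).filter (fun W => (e ∈ W ∧ f ∈ W) ∧ b' ∉ W)).card := by
    unfold thruCount
    have := card_filter_eq_sum_two (biIndepSets N k) (fun W => ({e, f} : Finset α) ⊆ W) b'
    rw [this]
    congr 1 <;> apply congrArg <;> apply filter_congr <;> intro W _ <;>
      simp only [insert_subset_iff, singleton_subset_iff]
  have h2 : thruCount N k {b', e} = ((biIndepSets N k).filter (fun W => (e ∈ W ∧ f ∈ W) ∧ b' ∈ W)).card +
      ((biIndepSets N k).filter (fun W => (e ∈ W ∧ f ∉ W) ∧ b' ∈ W)).card := by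
    unfold thruCount
    have := card_filter_eq_sum_two (biIndepSets N k) (fun W => ({b', e} : Finset α) ⊆ W) f
    rw [this]
    congr 1 <;> apply congrArg <;> apply filter_congr <;> intro W _ <;>
      simp only [insert_subset_iff, singleton_subset_iff] <;> tauto
  have h3 : thruCount N k {b', e, f} = ((biIndepSets N k).filter (fun W => (e ∈ W ∧ f ∈ W) ∧ b' ∈ W)).card := by
    unfold thruCount
    apply congrArg
    apply filter_congr
    intro W _
    simp only [insert_subset_iff, singleton_subset_iff]
    tauto
  have h4 : thruCount N k {b', f} = ((biIndepSets N k).filter (fun W => f ∈ W ∧ b' ∈ W)).card := by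
    unfold thruCount
    apply congrArg
    apply filter_congr
    intro W _
    simp only [insert_subset_iff, singleton_subset_iff]
    tauto
  unfold inCount at he hf ⊢
  rw [h1, h2, h3, h4]
  omega

/-- **THE `b′`-AVOIDING (★) AT A POINT `f` WITH A PARALLEL TWIN**: for every finite matroid, every level `k`, every
`b′`, and every `f` with a parallel twin `y ∉ {e, b′}`,
`in_k(e) + thru_k({b′, f}) + thru_k({b′, e, f}) ≤ in_k(f) + thru_k({e, f}) + thru_k({b′, e})` — the sets `W ∋ e ∌ f`
avoiding `b′` contain `y`, swap to sets `W ∋ e, f` avoiding `b′, y`, which are among the sets through `f` avoiding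
`b′`.  Its instance at `k = 4` on a nine-point coloop-free matroid with a series pair is the `f`-parallel regime of
`StarNineSharp`. -/
theorem inCount_thru_le_of_parallel (k : ℕ) {b' e f y : α} (hf : f ∈ gr N) (hy : y ∈ gr N) (hfy' : f ≠ y)
    (hf1 : rk N {f} = 1) (hy1 : rk N {y} = 1) (hfy : rk N {f, y} = 1) (hef : e ≠ f) (hey : e ≠ y)
    (hb'f : b' ≠ f) (hb'y : b' ≠ y) :
    inCount N k e + thruCount N k {b', f} + thruCount N k {b', e, f} ≤
      inCount N k f + thruCount N k {e, f} + thruCount N k {b', e} := by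
  rw [inCount_thru_split]
  have hyf : rk N {y, f} = 1 := by rw [pair_comm]; exact hfy
  -- the demands contain `y`
  have hD : ((biIndepSets N k).filter (fun W => (e ∈ W ∧ f ∉ W) ∧ b' ∉ W)).card =
      ((biIndepSets N k).filter (fun W => ((e ∈ W ∧ b' ∉ W) ∧ y ∈ W) ∧ f ∉ W)).card := by
    apply congrArg
    apply filter_congr
    intro W hW
    constructor
    · rintro ⟨⟨heW, hfW⟩, hb'W⟩
      refine ⟨⟨⟨heW, hb'W⟩, ?_⟩, hfW⟩
      rcases mem_or_mem_of_parallel hf hy hfy' hfy hW with h | h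
      · exact absurd h hfW
      · exact h
    · rintro ⟨⟨⟨heW, hb'W⟩, _⟩, hfW⟩
      exact ⟨⟨heW, hfW⟩, hb'W⟩
  have hswap := card_filter_swap_of_parallel hf hy hfy' hf1 hy1 hfy k (fun W => e ∈ W ∧ b' ∉ W)
    (fun W => by
      simp only [mem_insert, mem_erase]
      constructor
      · rintro ⟨he', hb''⟩
        refine ⟨he'.elim (fun h => absurd h hef) (fun h => h.2), fun h => hb'' (Or.inr ⟨hb'y, h⟩)⟩
      · rintro ⟨heW, hb'W⟩
        exact ⟨Or.inr ⟨hey, heW⟩, fun h => h.elim (fun h' => hb'f h') (fun h' => hb'W h'.2)⟩)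
    (fun W => by
      simp only [mem_insert, mem_erase]
      constructor
      · rintro ⟨he', hb''⟩
        refine ⟨he'.elim (fun h => absurd h hey) (fun h => h.2), fun h => hb'' (Or.inr ⟨hb'f, h⟩)⟩
      · rintro ⟨heW, hb'W⟩
        exact ⟨Or.inr ⟨hef, heW⟩, fun h => h.elim (fun h' => hb'y h') (fun h' => hb'W h'.2)⟩)
  rw [hD, hswap]
  apply card_le_card
  intro W hW
  rw [mem_filter] at hW ⊢
  exact ⟨hW.1, hW.2.2, hW.2.1.1.2⟩

/-- **THE IDENTITY AT A PARALLEL PAIR `{e, f}`**: when `e ∥ f` (`y = e`), both sides of the `b′`-avoiding (★) agree —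
no bi-independent set contains both, so the through-counts `thru_k({e, f})`, `thru_k({b′, e, f})` vanish, and the swap
`e ↔ f` gives `in_k(e) = in_k(f)` and `thru_k({b′, e}) = thru_k({b′, f})`. -/
theorem inCount_thru_eq_of_parallel (k : ℕ) {b' e f : α} (he : e ∈ gr N) (hf : f ∈ gr N) (hef : e ≠ f)
    (he1 : rk N {e} = 1) (hf1 : rk N {f} = 1) (hef1 : rk N {e, f} = 1) (hb'e : b' ≠ e) (hb'f : b' ≠ f) :
    inCount N k e + thruCount N k {b', f} + thruCount N k {b', e, f} =
      inCount N k f + thruCount N k {e, f} + thruCount N k {b', e} := by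
  have hfe1 : rk N {f, e} = 1 := by rw [pair_comm]; exact hef1
  have hthru : thruCount N k {e, f} = 0 := by
    unfold thruCount
    rw [card_eq_zero, filter_eq_empty_iff]
    intro W hW hsub
    rw [insert_subset_iff, singleton_subset_iff] at hsub
    exact not_and_of_parallel hef hef1 hW hsub
  have hthru3 : thruCount N k {b', e, f} = 0 := by
    unfold thruCount
    rw [card_eq_zero, filter_eq_empty_iff]
    intro W hW hsub
    rw [insert_subset_iff, insert_subset_iff, singleton_subset_iff] at hsub
    exact not_and_of_parallel hef hef1 hW ⟨hsub.2.1, hsub.2.2⟩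
  -- `in_k(e) = in_k(f)` by the swap `e ↔ f` (every set contains exactly one of them)
  have hin : inCount N k e = inCount N k f := by
    unfold inCount
    have h1 : ((biIndepSets N k).filter (fun W => e ∈ W)).card =
        ((biIndepSets N k).filter (fun W => (True ∧ e ∈ W) ∧ f ∉ W)).card := by
      apply congrArg; apply filter_congr; intro W hW
      constructor
      · intro heW; exact ⟨⟨trivial, heW⟩, fun hfW => not_and_of_parallel hef hef1 hW ⟨heW, hfW⟩⟩
      · rintro ⟨⟨_, heW⟩, _⟩; exact heW
    have h2 : ((biIndepSets N k).filter (fun W => f ∈ W)).card =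
        ((biIndepSets N k).filter (fun W => (True ∧ e ∉ W) ∧ f ∈ W)).card := by
      apply congrArg; apply filter_congr; intro W hW
      constructor
      · intro hfW; exact ⟨⟨trivial, fun heW => not_and_of_parallel hef hef1 hW ⟨heW, hfW⟩⟩, hfW⟩
      · rintro ⟨_, hfW⟩; exact hfW
    rw [h1, h2]
    exact card_filter_swap_of_parallel hf he hef.symm hf1 he1 hfe1 k (fun _ => True) (fun _ => Iff.rfl)
      (fun _ => Iff.rfl)
  -- `thru_k({b′, e}) = thru_k({b′, f})` by the same swap with `P W := b′ ∈ W`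
  have hthrub : thruCount N k {b', e} = thruCount N k {b', f} := by
    unfold thruCount
    have h1 : ((biIndepSets N k).filter (fun W => ({b', e} : Finset α) ⊆ W)).card =
        ((biIndepSets N k).filter (fun W => (b' ∈ W ∧ e ∈ W) ∧ f ∉ W)).card := by
      apply congrArg; apply filter_congr; intro W hW
      rw [insert_subset_iff, singleton_subset_iff]
      constructor
      · rintro ⟨hb'W, heW⟩; exact ⟨⟨hb'W, heW⟩, fun hfW => not_and_of_parallel hef hef1 hW ⟨heW, hfW⟩⟩
      · rintro ⟨⟨hb'W, heW⟩, _⟩; exact ⟨hb'W, heW⟩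
    have h2 : ((biIndepSets N k).filter (fun W => ({b', f} : Finset α) ⊆ W)).card =
        ((biIndepSets N k).filter (fun W => (b' ∈ W ∧ e ∉ W) ∧ f ∈ W)).card := by
      apply congrArg; apply filter_congr; intro W hW
      rw [insert_subset_iff, singleton_subset_iff]
      constructor
      · rintro ⟨hb'W, hfW⟩; exact ⟨⟨hb'W, fun heW => not_and_of_parallel hef hef1 hW ⟨heW, hfW⟩⟩, hfW⟩
      · rintro ⟨⟨hb'W, _⟩, hfW⟩; exact ⟨hb'W, hfW⟩
    rw [h1, h2]
    exact card_filter_swap_of_parallel hf he hef.symm hf1 he1 hfe1 k (fun W => b' ∈ W)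
      (fun W => by
        simp only [mem_insert, mem_erase]
        constructor
        · rintro (h | h)
          · exact absurd h hb'f
          · exact h.2
        · intro h; exact Or.inr ⟨hb'e, h⟩)
      (fun W => by
        simp only [mem_insert, mem_erase]
        constructor
        · rintro (h | h)
          · exact absurd h hb'e
          · exact h.2
        · intro h; exact Or.inr ⟨hb'f, h⟩)
  rw [hthru, hthru3, hin, hthrub]
  omega

/-- **THE `f`-PARALLEL REGIME OF `StarNineSharp`** (an instance of the general theorem with the Prop's hypotheses): on a
coloop-free nine-point matroid of rank `5` with a series pair `{b, b′}`, at every `(e, f)` outside the pair such that `f`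
has a parallel twin `y ∉ {e, b′}`, the Prop's inequality holds. -/
theorem starNineSharp_instance_of_parallel_twin (hn : (gr N).card = 9) (hR : rk N (gr N) = 5)
    (hcf : ∀ x ∈ gr N, rk N ((gr N).erase x) = 5) {b b' e f y : α} (h : SeriesPair N b b') (hf : f ∈ gr N)
    (hy : y ∈ gr N) (hfy' : f ≠ y) (hf1 : rk N {f} = 1) (hy1 : rk N {y} = 1) (hfy : rk N {f, y} = 1) (hef : e ≠ f)
    (hey : e ≠ y) (hb'f : b' ≠ f) (hb'y : b' ≠ y) :
    inCount N 4 e + thruCount N 4 {b', f} + thruCount N 4 {b', e, f} ≤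
      inCount N 4 f + thruCount N 4 {e, f} + thruCount N 4 {b', e} := by
  have _ := hn; have _ := hR; have _ := hcf; have _ := h
  exact inCount_thru_le_of_parallel 4 hf hy hfy' hf1 hy1 hfy hef hey hb'f hb'y

end StarSharpP

end PercRepro.Cogirth
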